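import Summits.AtomisticToContinuum.HydrodynamicLimit.Theorems.OneFlightGossipEngineClampedCurrentsDockPathwise
import Summits.AtomisticToContinuum.HydrodynamicLimit.Theorems.LambertianContactSwapLambertianEulerTimeLedgerStopping
import Literature.MathematicalPhysics.KineticTheory.LambertianRedrawNondegenerate
import HarnessLib

/-!
# Pathwise entropy production along the Lambertian flow
# (crux `LambertianEuler`, stmt-AtomisticToContinuum-11854, line `Sketch`, stub `stub_pathwiseProductionLambda`)

Helper file of the crux `Summit.AtomisticToContinuum.HydrodynamicLimit.Theses.LindebergRandomFuture.LambertianEuler`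
(route `LambertianContactSwap` / `RandomFutureLindeberg` of `AtomisticToContinuum/HydrodynamicLimit`),
line `Sketch`, registered stub `stub_pathwiseProductionLambda`.

**Statement.** Let `Λ_r = lambertFlow G ε ξs z r` be the Lambertian hard-sphere flow on `𝕋³`
(`Literature.MathematicalPhysics.KineticTheory.LambertianHardSphereFlow`: free flight `S` between the
collision instants `t_m = lambertInstant … m`, post-collisional states `z_m = lambertStateAfter … m`,
`Λ_r = S_{r - t_K} z_K`, `K = K_r = lambertCount … r`), `G = Torus.geometry (Fin 3)`,
`ε = hsDiameter σ N`. For profiles `a, θ > 0`, `u` jointly smooth on `[0, T) × 𝕋³`, the one-body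
exponent `g_t(x, v) = log a_t(x) − (3/2) log(2π θ_t(x)) − |v − u_t(x)|²/(2θ_t(x))` and its streaming
rate `Dg_t = ∂_t g + v·∇g`, a window `[s, s+h] ⊆ [0, T)` and a datum/noise `(z, ξs)` whose instants
pass beyond `s + h`:
`Σ_i g_{s+h}((Λ_{s+h})_i) − Σ_i g_s((Λ_s)_i) = ∫_s^{s+h} Σ_i Dg_r((Λ_r)_i) dr
  + Σ_{m < K_{s+h}} 1_{s < t_{m+1}} [Σ_i g_{t_{m+1}}((z_{m+1})_i) − Σ_i g_{t_{m+1}}((S_{τ(z_m)} z_m)_i)]`.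

**Proof route.** No property of the collision law is used: only that `Λ` is free flight from
`z_m` on `[t_m, t_{m+1})` and that the jump at `t_{m+1}` is, by definition, post-state minus
pre-state `S_{τ(z_m)} z_m = S_{t_{m+1} - t_m} z_m`.
* `sub_eq_integral_of_eqOn` — FTC (`intervalIntegral.integral_eq_sub_of_hasDerivAt_of_le`) for an
  abstract time-dependent observable `F` with streaming derivative `F'` along ONE free flight
  `r ↦ S_{r - t₀} w` on a piece `[α, β]` of the window, the integrand `F' r (γ r)` of any path `γ`
  agreeing with the free flight on `(α, β)` being a.e. equal (`integral_congr_Ioo_of_le`).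
* `sub_eq_integral_add_sum_range` — telescoping over the free segments of `Λ` cut by the window
  (downward induction on the collision index `n` from `K_{s+h}` to `K_s`, gluing the integrals with
  `integral_add_adjacent_intervals`; the bookkeeping `m < K_u ↔ t_{m+1} ≤ u`, `u < t_{m+1} ↔ K_u ≤ m`
  off the Zeno set is `…LambertianEulerTimeLedgerStopping` / `…LambertianEulerMarkov`). Degenerate
  segments (`τ(z_m) = 0`) contribute their jump and no integral.
* `stub_pathwiseProductionLambda` — the instance `F = Σ_i g`, `F' = Σ_i Dg` (the dynamics-free
  helpers `gSum`, `DgSum`, `hasDerivAt_slice_freeFlight`, `continuousOn_slice_freeFlight`,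
  `isSmoothSpaceTimeOn_gExp` of `…OneFlightGossipEngineClampedCurrentsDockPathwise`: along a free
  flight `d/dr g_r(x + r v, v) = (∂_t + v·∇) g`, at interior times of `[0, T)`).

**References.** H. Spohn, *Large Scale Dynamics of Interacting Particles* (1991), Part I §3.2
(3.3)–(3.8) (weak balance law along a piecewise-free trajectory); C. Cercignani, R. Illner,
M. Pulvirenti, *The Mathematical Theory of Dilute Gases* (1994), App. 4.A (collision-by-collision
construction). All `[folklore]`; no definitions, no named facts.
-/

noncomputable section

namespace Summit.AtomisticToContinuum.HydrodynamicLimit.Theorems.LambertianContactSwapLambertianEulerPathwiseProduction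

open scoped BigOperators Topology ENNReal InnerProductSpace
open MeasureTheory ProbabilityTheory Filter Set InformationTheory
open Literature.MathematicalPhysics.KineticTheory
open Literature.Analysis.FluidPDE Literature.Analysis.FluidPDE.Alexander
open Literature.Analysis.FunctionSpaces
open Summit.AtomisticToContinuum.HydrodynamicLimit.Theorems.LambertianContactSwapLambertianEulerMarkov
  (lambertSegment_of_count_eq)
open Summit.AtomisticToContinuum.HydrodynamicLimit.Theorems.LambertianContactSwapLambertianEulerTimeLedgerStopping
  (instant_succ_le_of_lt_lambertCount ofReal_lt_instant_succ_iff lambertCount_mono_of_le)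
open Summit.AtomisticToContinuum.HydrodynamicLimit.Theorems.ClampedCurrentsDockPathwise
  (gSum DgSum DgExp continuousOn_slice_freeFlight hasDerivAt_slice_freeFlight isSmoothSpaceTimeOn_gExp)

/-! ## FTC along one free flight, and the telescoping over the free segments of `Λ` -/

section Telescope

variable {d : Type*} [Fintype d] {X : Type*} {N : ℕ} {G : Geometry d X} {ε : ℝ}
  {ξs : ℕ → EuclideanSpace ℝ d} {z : Config N d X} {F F' : ℝ → Config N d X → ℝ} {s b : ℝ}
  (hF : ∀ (w : Config N d X) (t₀ : ℝ), ∀ r ∈ Ioo s b,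
    HasDerivAt (fun r => F r (freeFlight G (r - t₀) w)) (F' r (freeFlight G (r - t₀) w)) r)
  (hFc : ∀ (w : Config N d X) (t₀ : ℝ),
    ContinuousOn (fun r => F r (freeFlight G (r - t₀) w)) (Icc s b))
  (hF'i : ∀ (w : Config N d X) (t₀ : ℝ),
    IntervalIntegrable (fun r => F' r (freeFlight G (r - t₀) w)) volume s b)

include hF hFc hF'i

/-- **FTC along one free flight.** If along every free flight `r ↦ F r (S_{r-t₀} w)` is continuous on
`[s, b]` with derivative `F' r (S_{r-t₀} w)` at interior times, the latter interval integrable, then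
for a path `γ` that IS the free flight `S_{r-t₀} w` on `(α, β)`, `[α, β] ⊆ [s, b]`, the integrand
`r ↦ F' r (γ r)` is interval integrable on `[α, β]` and
`F β (S_{β-t₀} w) - F α (S_{α-t₀} w) = ∫_α^β F' r (γ r) dr` (the endpoints are a null set). [folklore] -/
theorem sub_eq_integral_of_eqOn {γ : ℝ → Config N d X} {w : Config N d X} {t₀ α β : ℝ}
    (hsα : s ≤ α) (hαβ : α ≤ β) (hβb : β ≤ b)
    (hγ : ∀ r ∈ Ioo α β, γ r = freeFlight G (r - t₀) w) :
    IntervalIntegrable (fun r => F' r (γ r)) volume α β ∧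
      F β (freeFlight G (β - t₀) w) - F α (freeFlight G (α - t₀) w) = ∫ r in α..β, F' r (γ r) := by
  have hsb : s ≤ b := hsα.trans (hαβ.trans hβb)
  have hderiv : ∀ r ∈ Ioo α β, HasDerivAt (fun r => F r (freeFlight G (r - t₀) w))
      (F' r (freeFlight G (r - t₀) w)) r := fun r hr =>
    hF w t₀ r ⟨hsα.trans_lt hr.1, hr.2.trans_le hβb⟩
  have hcont : ContinuousOn (fun r => F r (freeFlight G (r - t₀) w)) (Icc α β) :=
    (hFc w t₀).mono (Icc_subset_Icc hsα hβb)
  have hint : IntervalIntegrable (fun r => F' r (freeFlight G (r - t₀) w)) volume α β :=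
    (hF'i w t₀).mono_set
      (by rw [uIcc_of_le hαβ, uIcc_of_le hsb]; exact Icc_subset_Icc hsα hβb)
  have heq : EqOn (fun r => F' r (freeFlight G (r - t₀) w)) (fun r => F' r (γ r)) (Ioo α β) :=
    fun r hr => congrArg (F' r) (hγ r hr).symm
  refine ⟨hint.congr_uIoo (by rwa [uIoo_of_le hαβ]), ?_⟩
  rw [← intervalIntegral.integral_congr_Ioo_of_le hαβ heq,
    intervalIntegral.integral_eq_sub_of_hasDerivAt_of_le hαβ hcont hderiv hint]

/-- **Telescoping over the free segments of the Lambertian flow.** Under the analytic hypotheses of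
`sub_eq_integral_of_eqOn` on the window `[s, b]`, `0 ≤ s ≤ b`, for a datum/noise `(z, ξs)` whose
collision instants pass beyond `b`:
`F b (Λ_b) - F s (Λ_s) = ∫_s^b F' r (Λ_r) dr
  + Σ_{m < K_b} 1_{s < t_{m+1}} [F t_{m+1} (z_{m+1}) - F t_{m+1} (S_{τ(z_m)} z_m)]`
(`Λ` is free flight from `z_m` on `[t_m, t_{m+1})`, `lambertFlow_eq_of_segment`; the pre-collisional
state `S_{τ(z_m)} z_m = S_{t_{m+1} - t_m} z_m` is the end of the `m`-th free segment; downward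
induction on the collision index from `K_b` to `K_s`, `m < K_u ↔ t_{m+1} ≤ u`). [folklore] -/
theorem sub_eq_integral_add_sum_range (hs : 0 ≤ s) (hsb : s ≤ b)
    (hex : ∃ k, ENNReal.ofReal b < lambertInstant G ε ξs z k) :
    F b (lambertFlow G ε ξs z b) - F s (lambertFlow G ε ξs z s) =
      (∫ r in s..b, F' r (lambertFlow G ε ξs z r)) +
        ∑ m ∈ Finset.range (lambertCount G ε ξs z b),
          if s < (lambertInstant G ε ξs z (m + 1)).toReal then
            F (lambertInstant G ε ξs z (m + 1)).toReal (lambertStateAfter G ε ξs z (m + 1)) -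
              F (lambertInstant G ε ξs z (m + 1)).toReal
                (freeFlight G (freeExitTime G ε (lambertStateAfter G ε ξs z m)).toReal
                  (lambertStateAfter G ε ξs z m))
          else 0 := by
  obtain ⟨K, hK⟩ : ∃ K, lambertCount G ε ξs z b = K := ⟨_, rfl⟩
  obtain ⟨K₀, hK₀⟩ : ∃ K₀, lambertCount G ε ξs z s = K₀ := ⟨_, rfl⟩
  have hexs : ∃ k, ENNReal.ofReal s < lambertInstant G ε ξs z k :=
    hex.imp fun k hk => (ENNReal.ofReal_le_ofReal hsb).trans_lt hk
  have hK₀K : K₀ ≤ K := hK₀ ▸ hK ▸ lambertCount_mono_of_le hex hsb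
  obtain ⟨hbK1, hbK2⟩ := lambertSegment_of_count_eq hex hK
  obtain ⟨hsK1, hsK2⟩ := lambertSegment_of_count_eq hexs hK₀
  -- `m < K → t_{m+1} ≤ b`, `K₀ ≤ m → s < t_{m+1}`
  have hle_b : ∀ m, m < K → lambertInstant G ε ξs z (m + 1) ≤ ENNReal.ofReal b := fun m hm =>
    instant_succ_le_of_lt_lambertCount hex (hK ▸ hm)
  have hfin : ∀ m, m < K → lambertInstant G ε ξs z (m + 1) ≠ ∞ := fun m hm =>
    ne_top_of_le_ne_top ENNReal.ofReal_ne_top (hle_b m hm)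
  have hs_lt : ∀ m, K₀ ≤ m → m < K → s < (lambertInstant G ε ξs z (m + 1)).toReal := fun m h0 hm =>
    (ENNReal.ofReal_lt_iff_lt_toReal hs (hfin m hm)).1
      ((ofReal_lt_instant_succ_iff hexs).2 (hK₀ ▸ h0))
  -- downward induction on the collision index `n = K - j`, with a free left endpoint `α`
  have key : ∀ (j n : ℕ) (α : ℝ), n + j = K → K₀ ≤ n → s ≤ α → α ≤ b →
      lambertInstant G ε ξs z n ≤ ENNReal.ofReal α →
      (n < K → ENNReal.ofReal α ≤ lambertInstant G ε ξs z (n + 1)) →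
      IntervalIntegrable (fun r => F' r (lambertFlow G ε ξs z r)) volume α b ∧
        F b (lambertFlow G ε ξs z b) -
            F α (freeFlight G (α - (lambertInstant G ε ξs z n).toReal) (lambertStateAfter G ε ξs z n)) =
          (∫ r in α..b, F' r (lambertFlow G ε ξs z r)) +
            ∑ m ∈ Finset.Ico n K,
              if s < (lambertInstant G ε ξs z (m + 1)).toReal then
                F (lambertInstant G ε ξs z (m + 1)).toReal (lambertStateAfter G ε ξs z (m + 1)) -
                  F (lambertInstant G ε ξs z (m + 1)).toReal
                    (freeFlight G (freeExitTime G ε (lambertStateAfter G ε ξs z m)).toReal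
                      (lambertStateAfter G ε ξs z m))
              else 0 := by
    intro j
    induction j with
    | zero =>
      intro n α hn _ hsα hαb h1 _
      obtain rfl : n = K := by omega
      -- the last segment `[α, b] ⊆ [t_K, t_{K+1})`
      have hγ : ∀ r ∈ Ioo α b, lambertFlow G ε ξs z r =
          freeFlight G (r - (lambertInstant G ε ξs z n).toReal) (lambertStateAfter G ε ξs z n) := by
        intro r hr
        have hb0 : 0 < b := (hs.trans hsα).trans_lt (hr.1.trans hr.2)
        exact lambertFlow_eq_of_segment (h1.trans (ENNReal.ofReal_le_ofReal hr.1.le))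
          (((ENNReal.ofReal_lt_ofReal_iff hb0).2 hr.2).trans hbK2)
      obtain ⟨hint, heq⟩ := sub_eq_integral_of_eqOn hF hFc hF'i hsα hαb le_rfl hγ
      refine ⟨hint, ?_⟩
      rw [Finset.Ico_self, Finset.sum_empty, add_zero, ← heq, lambertFlow_eq_of_segment hbK1 hbK2]
    | succ j ih =>
      intro n α hn h0 hsα hαb h1 h2
      have hnK : n < K := by omega
      have htop : lambertInstant G ε ξs z (n + 1) ≠ ∞ := hfin n hnK
      have htop' : lambertInstant G ε ξs z n ≠ ∞ ∧
          freeExitTime G ε (lambertStateAfter G ε ξs z n) ≠ ∞ := by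
        rw [← ENNReal.add_ne_top, ← lambertInstant_succ]; exact htop
      -- the collision instant `tc = t_{n+1} ∈ (s, b]` as a real
      have hstc : s < (lambertInstant G ε ξs z (n + 1)).toReal := hs_lt n h0 hnK
      have htcb : (lambertInstant G ε ξs z (n + 1)).toReal ≤ b :=
        ENNReal.toReal_le_of_le_ofReal (hs.trans hsb) (hle_b n hnK)
      have hαtc : α ≤ (lambertInstant G ε ξs z (n + 1)).toReal :=
        (ENNReal.ofReal_le_iff_le_toReal htop).1 (h2 hnK)
      have htc_eq : (lambertInstant G ε ξs z (n + 1)).toReal =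
          (lambertInstant G ε ξs z n).toReal +
            (freeExitTime G ε (lambertStateAfter G ε ξs z n)).toReal := by
        rw [lambertInstant_succ, ENNReal.toReal_add htop'.1 htop'.2]
      -- the induction hypothesis from `tc` on, started at `z_{n+1}`
      obtain ⟨hint₂, heq₂⟩ := ih (n + 1) (lambertInstant G ε ξs z (n + 1)).toReal (by omega)
        (h0.trans n.le_succ) hstc.le htcb (by rw [ENNReal.ofReal_toReal htop])
        (fun _ => ENNReal.ofReal_toReal_le.trans (monotone_lambertInstant ξs z (n + 1).le_succ))
      rw [sub_self, freeFlight_zero] at heq₂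
      -- FTC on `[α, tc]` along the `n`-th free segment
      have hγ : ∀ r ∈ Ioo α (lambertInstant G ε ξs z (n + 1)).toReal, lambertFlow G ε ξs z r =
          freeFlight G (r - (lambertInstant G ε ξs z n).toReal) (lambertStateAfter G ε ξs z n) := by
        intro r hr
        exact lambertFlow_eq_of_segment (h1.trans (ENNReal.ofReal_le_ofReal hr.1.le))
          ((ENNReal.ofReal_lt_iff_lt_toReal ((hs.trans hsα).trans hr.1.le) htop).2 hr.2)
      obtain ⟨hint₁, heq₁⟩ := sub_eq_integral_of_eqOn hF hFc hF'i hsα hαtc htcb hγ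
      rw [htc_eq, add_sub_cancel_left, ← htc_eq] at heq₁
      refine ⟨hint₁.trans hint₂, ?_⟩
      rw [← intervalIntegral.integral_add_adjacent_intervals hint₁ hint₂,
        Finset.sum_eq_sum_Ico_succ_bot hnK, if_pos hstc]
      linarith
  -- the claim is `key` at `n = K₀`, `α = s`
  obtain ⟨-, heq⟩ := key (K - K₀) K₀ s (by omega) le_rfl le_rfl hsb hsK1 (fun _ => hsK2.le)
  rw [lambertFlow_eq_of_segment hsK1 hsK2, heq, hK, ← Finset.sum_range_add_sum_Ico _ hK₀K]
  have h0 : ∑ m ∈ Finset.range K₀,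
      (if s < (lambertInstant G ε ξs z (m + 1)).toReal then
        F (lambertInstant G ε ξs z (m + 1)).toReal (lambertStateAfter G ε ξs z (m + 1)) -
          F (lambertInstant G ε ξs z (m + 1)).toReal
            (freeFlight G (freeExitTime G ε (lambertStateAfter G ε ξs z m)).toReal
              (lambertStateAfter G ε ξs z m))
      else 0) = 0 := by
    refine Finset.sum_eq_zero fun m hm => if_neg (not_lt.2 ?_)
    exact ENNReal.toReal_le_of_le_ofReal hs
      (instant_succ_le_of_lt_lambertCount hexs (hK₀ ▸ Finset.mem_range.1 hm))
  rw [h0, zero_add]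

end Telescope

/-! ## The stub: the instance `F = Σ_i g`, `F' = Σ_i Dg` on `𝕋³` -/

/-- **STUB `stub_pathwiseProductionLambda`** (line `Sketch`, crux `LambertianEuler`,
stmt-AtomisticToContinuum-11854): **pathwise entropy production along the Lambertian flow.** For
profiles `a, θ > 0`, `u` jointly smooth on `[0, T) × 𝕋³`, a datum `z`, a noise `ξs` whose collision
instants pass beyond `s + h`, `0 ≤ s`, `0 ≤ h`, `s + h < T`: the one-body exponent
`Σ_i g_r((Λ_r z)_i)`, `g = log a − (3/2) log(2πθ) − |v − u|²/(2θ)`, changes over `[s, s+h]` by the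
streaming integral `∫_s^{s+h} Σ_i Dg_r((Λ_r z)_i) dr`, `Dg = ∂_t g + v·∇g` (torus calculus,
`timeDerivWithin (Ico 0 T)` / `partialDeriv`), plus the raw collision jumps
`Σ_{m < K_{s+h}, s < t_{m+1}} [Σ_i g_{t_{m+1}}((z_{m+1})_i) − Σ_i g_{t_{m+1}}((S_{τ(z_m)} z_m)_i)]`
(`sub_eq_integral_add_sum_range` for `F = gSum a θ u`, `F' = DgSum T a θ u`, whose analytic inputs
along free flight are the streaming chain rule `hasDerivAt_slice_freeFlight` and
`continuousOn_slice_freeFlight` for the jointly smooth slices `isSmoothSpaceTimeOn_gExp`). [folklore] -/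
theorem stub_pathwiseProductionLambda :
    ∀ {σ : ℝ}, 0 < σ → σ < 2⁻¹ → ∀ (T : ℝ) (N : ℕ) (a θ : ℝ → T3 → ℝ) (u : ℝ → T3 → V3),
      Literature.Analysis.FunctionSpaces.Torus.IsSmoothSpaceTimeOn (Set.Ico 0 T) a →
      Literature.Analysis.FunctionSpaces.Torus.IsSmoothSpaceTimeOn (Set.Ico 0 T) θ →
      Literature.Analysis.FunctionSpaces.Torus.IsSmoothSpaceTimeOn (Set.Ico 0 T) u →
      (∀ t ∈ Set.Ico 0 T, ∀ x, 0 < a t x) → (∀ t ∈ Set.Ico 0 T, ∀ x, 0 < θ t x) →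
      ∀ (z : Config (N + 1) (Fin 3) T3) (ξs : ℕ → V3) (s h : ℝ), 0 ≤ s → 0 ≤ h → s + h < T →
        (∃ k, ENNReal.ofReal (s + h) < lambertInstant (Torus.geometry (Fin 3)) (hsDiameter σ N) ξs z k) →
        (let g := fun (t : ℝ) (y : T3 × V3) =>
           Real.log (a t y.1) - 3 / 2 * Real.log (2 * Real.pi * θ t y.1) - ‖y.2 - u t y.1‖ ^ 2 / (2 * θ t y.1)
         let Dg := fun (t : ℝ) (y : T3 × V3) =>
           Literature.Analysis.FunctionSpaces.Torus.timeDerivWithin (Set.Ico 0 T) (fun t' x => g t' (x, y.2)) t y.1 +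
             ∑ k : Fin 3, y.2 k * Literature.Analysis.FunctionSpaces.Torus.partialDeriv k (fun x => g t (x, y.2)) y.1
         let Λ := fun r : ℝ => lambertFlow (Torus.geometry (Fin 3)) (hsDiameter σ N) ξs z r
         let tc := fun m : ℕ => (lambertInstant (Torus.geometry (Fin 3)) (hsDiameter σ N) ξs z (m + 1)).toReal
         let zpre := fun m : ℕ => freeFlight (Torus.geometry (Fin 3))
             (freeExitTime (Torus.geometry (Fin 3)) (hsDiameter σ N)
               (lambertStateAfter (Torus.geometry (Fin 3)) (hsDiameter σ N) ξs z m)).toReal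
             (lambertStateAfter (Torus.geometry (Fin 3)) (hsDiameter σ N) ξs z m)
         let zpost := fun m : ℕ => lambertStateAfter (Torus.geometry (Fin 3)) (hsDiameter σ N) ξs z (m + 1)
         (∑ i, g (s + h) (Λ (s + h) i)) - ∑ i, g s (Λ s i) =
           (∫ r in s..(s + h), ∑ i, Dg r (Λ r i)) +
             ∑ m ∈ Finset.range (lambertCount (Torus.geometry (Fin 3)) (hsDiameter σ N) ξs z (s + h)),
               if s < tc m then (∑ i, g (tc m) (zpost m i)) - ∑ i, g (tc m) (zpre m i) else 0) := by
  intro σ _ _ T N a θ u ha hθ hu ha0 hθ0 z ξs s h hs hh hshT hex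
  have hU : UniqueDiffOn ℝ (Ico 0 T) := uniqueDiffOn_Ico 0 T
  have hIcc : Icc s (s + h) ⊆ Ico 0 T := fun r hr => ⟨hs.trans hr.1, hr.2.trans_lt hshT⟩
  have hg := fun v : V3 => isSmoothSpaceTimeOn_gExp ha hθ hu ha0 hθ0 v
  -- the analytic inputs along free flight for `F = gSum`, `F' = DgSum` (as in the deterministic file)
  have hF : ∀ (w : Config (N + 1) (Fin 3) T3) (t₀ : ℝ), ∀ r ∈ Ioo s (s + h),
      HasDerivAt (fun r => gSum a θ u r (freeFlight (Torus.geometry (Fin 3)) (r - t₀) w))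
        (DgSum T a θ u r (freeFlight (Torus.geometry (Fin 3)) (r - t₀) w)) r := by
    intro w t₀ r hr
    have hrS : Ico 0 T ∈ 𝓝 r :=
      mem_of_superset (Ioo_mem_nhds (hs.trans_lt hr.1) (hr.2.trans hshT)) Ioo_subset_Ico_self
    simp only [gSum, DgSum, DgExp, freeFlight_apply, Torus.geometry_translate]
    exact HasDerivAt.fun_sum fun i _ => hasDerivAt_slice_freeFlight (hg (w i).2) hU hrS (w i).1 (w i).2 t₀
  have hFc : ∀ (w : Config (N + 1) (Fin 3) T3) (t₀ : ℝ),
      ContinuousOn (fun r => gSum a θ u r (freeFlight (Torus.geometry (Fin 3)) (r - t₀) w))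
        (Icc s (s + h)) := by
    intro w t₀
    simp only [gSum, freeFlight_apply, Torus.geometry_translate]
    exact continuousOn_finsetSum _ fun i _ =>
      (continuousOn_slice_freeFlight (hg (w i).2).continuousOn_stLift (w i).1 (w i).2 t₀).mono hIcc
  have hF'c : ∀ (w : Config (N + 1) (Fin 3) T3) (t₀ : ℝ),
      ContinuousOn (fun r => DgSum T a θ u r (freeFlight (Torus.geometry (Fin 3)) (r - t₀) w))
        (Icc s (s + h)) := by
    intro w t₀
    simp only [DgSum, DgExp, freeFlight_apply, Torus.geometry_translate]
    refine continuousOn_finsetSum _ fun i _ => ContinuousOn.mono ?_ hIcc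
    refine (continuousOn_slice_freeFlight ((hg (w i).2).timeDerivWithin hU).continuousOn_stLift
      (w i).1 (w i).2 t₀).add (continuousOn_finsetSum _ fun k _ => continuousOn_const.mul ?_)
    exact continuousOn_slice_freeFlight ((hg (w i).2).partialDeriv hU k).continuousOn_stLift
      (w i).1 (w i).2 t₀
  exact sub_eq_integral_add_sum_range hF hFc
    (fun w t₀ => (hF'c w t₀).intervalIntegrable_of_Icc (le_add_of_nonneg_right hh)) hs
    (le_add_of_nonneg_right hh) hex

end Summit.AtomisticToContinuum.HydrodynamicLimit.Theorems.LambertianContactSwapLambertianEulerPathwiseProduction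

end
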